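import Summits.QuantumFields.YangMills.Theorems.FluctuationComparisonRegPrIntLOrganTangentWhiteningKernelLipOfLetters
import Summits.QuantumFields.YangMills.Theorems.FluctuationComparisonRegPrIntLOrganTangentD0ChartLettersWhitened
import HarnessLib

/-!
# Crux `FluctuationComparisonRegPrIntL` (stmt-QuantumFields-20520, rung R3), PATH-B organ (covariant organ of record, RULING №56) — (L52) «(Dwhite∣MW) DOCKING»:
# ✓(L50b)'s letter (Dwhite∣MW) — «the whitened fluctuation `Wh V z = K_V^{−1∕2}z` moves by `≤ kW e·‖u‖` bondwise under a one-bond coarse move of the background, on the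
# multiwindow-good segment» — FROM px19 g23's ✓p827976 `whiteningKernel_mulVec_lip` (the square-root kernel is matrix–vector Lipschitz in a complex background
# parameter) + a READING letter (W-read) + a WINDOW letter (z-window∣MW); conclusion = ✓`dlinkPath∕Square_of_dmin_dwhite`'s `hDwhite` binder text VERBATIM

Cell `ym3-torus` (YM ladder rung R3 = continuum `SU(2)` Yang–Mills on the three-torus — a RUNG: NOT d = 4, NOT infinite volume, NOT a mass gap, NOT Clay).
Width seat `ym-ust-20520-w5` (gen 26), `--kind proof --supports stmt-QuantumFields-20520 --as helper`, count-neutral, DEFINITION-FREE, default heartbeats,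
no registry ∕ binder ∕ `Lines/` edit.  Over ✓p827976 `…OrganTangentWhiteningKernelLipOfLetters` (`whiteningKernel_mulVec_lip`, px19 g23 — first refusal on the shape below),
lit ✓`B13RealSliceEntryLetters` (`realStructureComplex`, `lam`), lit ✓`B13Sqrt27Accretive` (`invSqrt`), `T4CubeChartExp.expPt_zero`.

THE LETTERS (hypothesis texts; `V` a `θ_j`-small coarse field, `b` a coarse bond, `w` a unit direction `‖w‖ ≤ 1`, `s` real):
* (W-fam) a complex matrix family `A V b w : ℂ → Matrix p p ℂ` — INHABITANT: `u ↦ K_{V_u}`, the fluctuation operator of the whitened covariant chart along the COMPLEXIFIED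
  one-bond move `V_u = update V b (V b·expPointC(u•ŵ))` (px19 g22 ✓p827459's slice device), `p` = the real coordinates of the unit-lattice fluctuation field (bond × colour),
  `loc` their sites; with px19's three print-shaped letters on it: (W-holo) entrywise holomorphy on `ball 0 R` ([Balaban1985BackgroundPropagators] Thm 3.4 p.400: «can be
  extended to analytic functions … small perturbations of the operators depending on U only»), (W-acc) ONE accretivity margin `m > 0` there (the curved multi-level
  coercivity, [Balaban1985BackgroundPropagators] Thm 3.11∕3.12 — UV3-NODE §92.2 L2-a, MISSING in the tree for the curved multi-level case), (W-real) REAL-slice decay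
  `‖K_{V_v}^{−1∕2}(i,j′)‖ ≤ B·e^{−ρ·d(i,j′)}` ([Balaban1988RG2Cluster] (2.7) p.13 + the generalized random walk; lit ✓`B13Sqrt27.abs_invSqrt_apply_le_of_decay`; §92.2 L2-b).
* (W-read) «`Wh (update V b (V b·expPt (s•w))) z e k = Re ((invSqrt (A V b w ↑s) *ᵥ coord z) (idx e k))`» for `|s| ≤ δ₀` with the moved field `θ_j`-small — the READING of
  the organ's `Wh` (✓(L50b)'s structure letter (Φw): `Φ (V,z) e = Amin V e·expPt (Wh V z e)`) through the family: `Wh V z = K_V^{−1∕2}z` is LINEAR in the fibre coordinates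
  `coord z` with matrix `invSqrt K_V`, real on real backgrounds; `idx e k` = the coordinate index of (bond `e`, colour `k`).  At `s = 0` it reads `Wh V z` itself.
* (z-window∣MW) «multiwindow-good along the open segment ⟹ `‖coord z j′‖ ≤ Zw`» — the fibre coordinates of a configuration whose chart image stays in every window are
  window-bounded (D0-chart business: the chart is a window chart; kept a LETTER here).
* `hkW` — the consumer's modulus `kW e` DOMINATES the row-sum shape `(4∕R′)·(Σ_{j′} B′·e^{−ρ′·d(idx e k, j′)})·Zw` for each colour `k` (`R′ = (r∕(1+r))R`,
  `B′ = B^{1−λ(r)}(max B (2∕√m))^{λ(r)}`, `ρ′ = (1−λ(r))ρ` — ✓p827976's constants); its m-UNIFORMITY is exactly that of `(m, B, ρ, R)` (UV3-NODE §92.2 layer (2)).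
INHABITATION (★★OWNER RULING №100): LAW-FREE — statements about the chart objects `Wh`, `coord`, `A` pointwise in `z`; no fibre law, no score.

WHAT.  §0 [folklore] `norm_inv_smul_le_one`, `eq_norm_smul_inv_smul` (`u = ‖u‖ • (‖u‖⁻¹ • u)`, `‖‖u‖⁻¹ • u‖ ≤ 1`), `ofReal_mem_Ereal`.  §1 ★★★`dwhite_of_whiteningKernel` — (W-fam)+(W-holo)+(W-acc)+(W-real)
+ (W-read) + (z-window∣MW) + `hkW` + the guard `δ₀ < R′∕2` ⟹ ✓(L50b)'s `hDwhite` binder text VERBATIM (so `dlinkPath∕Square_of_dmin_dwhite … hDmin (dwhite_of_whiteningKernel …)`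
type-check by name).  Proof: write `u = s•w`, `s = ‖u‖`, `‖w‖ ≤ 1`; read both `Wh` values through (W-read) (`s` and `0`; `expPt (0•w) = 1`, `update V b (V b) = V`); the
difference of real parts is bounded by the norm of `((invSqrt (A ↑s) − invSqrt (A 0)) *ᵥ coord z) (idx e k)`, which ✓`whiteningKernel_mulVec_lip` bounds by the row-sum
shape × `Zw` × `‖↑s − 0‖ = ‖u‖`; sup over the three colours.

HONEST FRAMING: a door between HYPOTHESIS letters; (W-holo)∕(W-acc)∕(W-real) for the ACTUAL `K_V` of the whitened covariant chart, (W-read) and (z-window∣MW) are D0's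
content (crux 19200 EX ∧ V2′; the curved multi-level letters of [Balaban1985BackgroundPropagators] §3) and are NOT proved here; (Dmin), (χ-Lip∣MW), (I-curv), (I-cov), KER′
letters, rows v0.1–v0.4 UNDISCHARGED; nothing of Bałaban's analysis is asserted or proved; the five registered stubs of `Lines/semiclassical_s2beta.lean`, crux 20520 and
`YM3TorusSU2` are NOT proved; registry untouched; rung R3 = SU(2) YM₃ on T³ — NOT d = 4, NOT infinite volume, NOT a mass gap, NOT Clay; the Yang–Mills mass gap is NOT
proved.  [folklore]
-/

set_option autoImplicit false

noncomputable section

namespace Summit.QuantumFields.YangMills.Theorems.OrganTangentDwhiteOfWhiteningKernel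

open Function Set Metric Finset
open scoped NNReal Matrix
open Literature.MathematicalPhysics.QuantumFieldTheory
open Literature.MathematicalPhysics.QuantumFieldTheory.Balaban1983to89 T3ContinuumYM3Torus T3NestedUnitLaws
  T3UnitLawDensityEML T4Continuum BalabanUVClass T3UnitScaleTilt T3LevelShift T3TiltDescent
open T4CubeChartExp (expPt expPt_zero)
open Literature.MathematicalPhysics.QuantumFieldTheory.Balaban1983to89.B9Thm37GlueTorus (tdist1)
open Literature.MathematicalPhysics.QuantumFieldTheory.Balaban1983to89.B5TorusCover (UT)
open Literature.MathematicalPhysics.QuantumFieldTheory.Balaban1983to89.B13Sqrt27Accretive (invSqrt)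
open Literature.MathematicalPhysics.QuantumFieldTheory.Balaban1983to89.B13RealSliceEntryLetters (realStructureComplex lam)
open Summit.QuantumFields.YangMills.Theorems.OrganTangentWhiteningKernelLipOfLetters (whiteningKernel_mulVec_lip)

/-! ## §0 Folklore -/

/-- A non-zero `u` is `‖u‖` times a direction of norm `≤ 1` (in fact `= 1`). [folklore] -/
theorem norm_inv_smul_le_one {E : Type*} [NormedAddCommGroup E] [NormedSpace ℝ E] (u : E) : ‖(‖u‖⁻¹ : ℝ) • u‖ ≤ 1 := by
  rw [norm_smul, norm_inv, norm_norm]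
  exact inv_mul_le_one

/-- `u = ‖u‖ • (‖u‖⁻¹ • u)` for `u ≠ 0`. [folklore] -/
theorem eq_norm_smul_inv_smul {E : Type*} [NormedAddCommGroup E] [NormedSpace ℝ E] {u : E} (hu : u ≠ 0) : u = ‖u‖ • ((‖u‖⁻¹ : ℝ) • u) := by
  rw [smul_smul, mul_inv_cancel₀ (norm_ne_zero_iff.mpr hu), one_smul]

/-- A real number coerced to `ℂ` lies on the real axis of `realStructureComplex`. [folklore] -/
theorem ofReal_mem_Ereal (s : ℝ) : (s : ℂ) ∈ realStructureComplex.Ereal := ⟨s, rfl⟩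

/-! ## §1 (Dwhite∣MW) from the whitening kernel's background-Lipschitz bound -/

section Dock

variable {ν : ℕ} {Nf : Fin ν → ℕ} [∀ i, NeZero (Nf i)]
variable {p : Type} [Fintype p] [DecidableEq p]

/-- ★★★ **(Dwhite∣MW) DOCKED ON THE WHITENING KERNEL** — conclusion = the `hDwhite` binder text of ✓`dlinkPath_of_dmin_dwhite` ∕ ✓`dlinkSquare_of_dmin_dwhite` VERBATIM;
hypotheses = (W-fam) with px19's (W-holo)∕(W-acc)∕(W-real), the reading (W-read), the window letter (z-window∣MW), the domination `hkW`, the guard `δ₀ < R′∕2`.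
[cite: Balaban1988RG2Cluster, (2.7) p.13; Balaban1985BackgroundPropagators, Thm 3.4 p.400, Thm 3.10 (3.108) p.416] -/
theorem dwhite_of_whiteningKernel (F : T3Family) (γ b₀ p₀ : ℝ) (j Ts : ℕ) {Z : Type}
    (Φ : GaugeField (F.P j) 0 ↥(Matrix.specialUnitaryGroup (Fin 2) ℂ) × Z → GaugeField (F.P Ts) 0 ↥(Matrix.specialUnitaryGroup (Fin 2) ℂ))
    (Wh : GaugeField (F.P j) 0 ↥(Matrix.specialUnitaryGroup (Fin 2) ℂ) → Z → PBond (F.P Ts) 0 → (Fin 3 → ℝ))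
    (loc : p → UT Nf) (idx : PBond (F.P Ts) 0 → Fin 3 → p) (coord : Z → p → ℂ)
    -- (W-fam): the whitening-kernel family along unit-direction one-bond moves of the background, complexified
    (A : GaugeField (F.P j) 0 ↥(Matrix.specialUnitaryGroup (Fin 2) ℂ) → PBond (F.P j) 0 → (Fin 3 → ℝ) → ℂ → Matrix p p ℂ)
    (R m ρ B r δ₀ Zw : ℝ) (hR : 0 < R) (hm : 0 < m) (hB0 : 0 ≤ B) (hρ : 0 ≤ ρ) (hr0 : 0 < r) (hr1 : r < 1) (hZw : 0 ≤ Zw)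
    (hδ₀R : δ₀ < r / (1 + r) * R / 2)
    -- (W-holo), (W-acc), (W-real): px19 g23's three letters (✓`whiteningKernel_mulVec_lip`), for every `θ_j`-small `V`, bond `b`, direction `‖w‖ ≤ 1`
    (hA : ∀ (V : GaugeField (F.P j) 0 ↥(Matrix.specialUnitaryGroup (Fin 2) ℂ)) (b : PBond (F.P j) 0) (w : Fin 3 → ℝ), PlaqSmall (θBal F.L γ b₀ p₀ j) V → ‖w‖ ≤ 1 →
      ∀ i j', DifferentiableOn ℂ (fun u => A V b w u i j') (ball (0 : ℂ) R))
    (hacc : ∀ (V : GaugeField (F.P j) 0 ↥(Matrix.specialUnitaryGroup (Fin 2) ℂ)) (b : PBond (F.P j) 0) (w : Fin 3 → ℝ), PlaqSmall (θBal F.L γ b₀ p₀ j) V → ‖w‖ ≤ 1 →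
      ∀ u ∈ ball (0 : ℂ) R, ∀ v : p → ℂ, m * ∑ i, ‖v i‖ ^ 2 ≤ (∑ i, star (v i) * (A V b w u *ᵥ v) i).re)
    (hreal : ∀ (V : GaugeField (F.P j) 0 ↥(Matrix.specialUnitaryGroup (Fin 2) ℂ)) (b : PBond (F.P j) 0) (w : Fin 3 → ℝ), PlaqSmall (θBal F.L γ b₀ p₀ j) V → ‖w‖ ≤ 1 →
      ∀ v ∈ realStructureComplex.Ereal, ‖v‖ < R → ∀ i j', ‖invSqrt (A V b w v) i j'‖ ≤ B * Real.exp (-(ρ * tdist1 Nf (loc i) (loc j'))))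
    -- (W-read): the organ's `Wh` READ through the family on real parameters (at `s = 0` it reads `Wh V z` itself)
    (hread : ∀ (V : GaugeField (F.P j) 0 ↥(Matrix.specialUnitaryGroup (Fin 2) ℂ)) (b : PBond (F.P j) 0) (w : Fin 3 → ℝ) (s : ℝ), PlaqSmall (θBal F.L γ b₀ p₀ j) V → ‖w‖ ≤ 1 →
      |s| ≤ δ₀ → PlaqSmall (θBal F.L γ b₀ p₀ j) (update V b (V b * expPt (s • w))) →
      ∀ (z : Z) (e : PBond (F.P Ts) 0) (k : Fin 3), Wh (update V b (V b * expPt (s • w))) z e k = ((invSqrt (A V b w (s : ℂ)) *ᵥ coord z) (idx e k)).re)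
    -- (z-window∣MW): on the multiwindow-good open segment the fibre coordinates are window-bounded
    (hwin : ∀ (z : Z) (V : GaugeField (F.P j) 0 ↥(Matrix.specialUnitaryGroup (Fin 2) ℂ)) (b : PBond (F.P j) 0) (u : Fin 3 → ℝ), PlaqSmall (θBal F.L γ b₀ p₀ j) V →
      PlaqSmall (θBal F.L γ b₀ p₀ j) (update V b (V b * expPt u)) → ‖u‖ ≤ δ₀ →
      (∀ r ∈ Set.Ioo (0:ℝ) 1, ∀ (n : ℕ) (hjn : j + 1 ≤ n) (hnK : n ≤ Ts), PlaqSmall (24 / 25 * θBal F.L γ b₀ p₀ n) (descendTo F ℰp n Ts hnK (Φ (update V b (V b * expPt (r • u)), z)))) →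
      ∀ j', ‖coord z j'‖ ≤ Zw)
    -- the consumer's modulus dominates the row-sum shape, colour by colour
    (kW : PBond (F.P Ts) 0 → ℝ)
    (hkW : ∀ e k, (4 / (r / (1 + r) * R)) *
          (∑ j', (B ^ (1 - lam r) * (max B (2 / Real.sqrt m)) ^ lam r) * Real.exp (-((1 - lam r) * ρ * tdist1 Nf (loc (idx e k)) (loc j')))) * Zw ≤ kW e) :
    ∀ (z : Z) (V : GaugeField (F.P j) 0 ↥(Matrix.specialUnitaryGroup (Fin 2) ℂ)) (b : PBond (F.P j) 0) (u : Fin 3 → ℝ), PlaqSmall (θBal F.L γ b₀ p₀ j) V →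
      PlaqSmall (θBal F.L γ b₀ p₀ j) (update V b (V b * expPt u)) → ‖u‖ ≤ δ₀ →
      (∀ r ∈ Set.Ioo (0:ℝ) 1, ∀ (n : ℕ) (hjn : j + 1 ≤ n) (hnK : n ≤ Ts), PlaqSmall (24 / 25 * θBal F.L γ b₀ p₀ n) (descendTo F ℰp n Ts hnK (Φ (update V b (V b * expPt (r • u)), z)))) →
      ∀ e, ‖Wh (update V b (V b * expPt u)) z e - Wh V z e‖ ≤ kW e * ‖u‖ := by
  intro z V b u hV hV' hu hMW e
  have hZ := hwin z V b u hV hV' hu hMW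
  -- the degenerate move
  by_cases hu0 : u = 0
  · subst hu0
    have hVV : update V b (V b * expPt 0) = V := by rw [expPt_zero, mul_one, update_eq_self]
    rw [hVV, sub_self, norm_zero, mul_zero]
  -- direction `‖u‖⁻¹ • u` (norm ≤ 1) and size `‖u‖`
  have hw1 : ‖(‖u‖⁻¹ : ℝ) • u‖ ≤ 1 := norm_inv_smul_le_one u
  have hsw : ‖u‖ • ((‖u‖⁻¹ : ℝ) • u) = u := (eq_norm_smul_inv_smul hu0).symm
  have hsδ : |‖u‖| ≤ δ₀ := by rw [abs_norm]; exact hu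
  have hV's : PlaqSmall (θBal F.L γ b₀ p₀ j) (update V b (V b * expPt (‖u‖ • ((‖u‖⁻¹ : ℝ) • u)))) := by rw [hsw]; exact hV'
  have hV0 : PlaqSmall (θBal F.L γ b₀ p₀ j) (update V b (V b * expPt ((0:ℝ) • ((‖u‖⁻¹ : ℝ) • u)))) := by
    rw [zero_smul, expPt_zero, mul_one, update_eq_self]; exact hV
  have h0δ : |(0:ℝ)| ≤ δ₀ := by rw [abs_zero]; exact (abs_nonneg _).trans hsδ
  -- read both values through the family
  have hrd1 := hread V b ((‖u‖⁻¹ : ℝ) • u) ‖u‖ hV hw1 hsδ hV's z e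
  have hrd0 := hread V b ((‖u‖⁻¹ : ℝ) • u) 0 hV hw1 h0δ hV0 z e
  rw [hsw] at hrd1
  rw [zero_smul, expPt_zero, mul_one, update_eq_self, Complex.ofReal_zero] at hrd0
  -- px19's bound between the complex parameters `0` and `↑‖u‖`
  have hR' : 0 < r / (1 + r) * R / 2 := by positivity
  have hus : ‖((‖u‖ : ℝ) : ℂ)‖ < r / (1 + r) * R / 2 := by
    rw [Complex.norm_real, Real.norm_eq_abs]; exact hsδ.trans_lt hδ₀R
  have hu0' : ‖(0 : ℂ)‖ < r / (1 + r) * R / 2 := by rw [norm_zero]; exact hR'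
  have key : ∀ k : Fin 3, |Wh (update V b (V b * expPt u)) z e k - Wh V z e k| ≤ kW e * ‖u‖ := by
    intro k
    rw [hrd1 k, hrd0 k]
    rw [← Complex.sub_re, ← Pi.sub_apply, ← Matrix.sub_mulVec]
    refine (Complex.abs_re_le_norm _).trans ?_
    refine (whiteningKernel_mulVec_lip realStructureComplex hR hm (hA V b _ hV hw1) (hacc V b _ hV hw1) (hreal V b _ hV hw1) hB0 hρ hr0 hr1
      hu0' hus hZw hZ (idx e k)).trans ?_
    rw [sub_zero, Complex.norm_real, Real.norm_eq_abs, abs_norm]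
    exact mul_le_mul_of_nonneg_right (hkW e k) (norm_nonneg u)
  exact (pi_norm_le_iff_of_nonneg ((abs_nonneg _).trans (key 0))).2 fun k => by rw [Real.norm_eq_abs]; exact key k

end Dock

end Summit.QuantumFields.YangMills.Theorems.OrganTangentDwhiteOfWhiteningKernel

end
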